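import Literature.MathematicalPhysics.QuantumLattice.DWaveSourceNNNHoppingWindowHamiltonian
import Literature.MathematicalPhysics.QuantumLattice.HubbardFermionInteractionLocalHamiltonian
import Literature.MathematicalPhysics.QuantumLattice.HubbardTTPrimeSourcedMeanEnergyMinimisers
import Literature.MathematicalPhysics.QuantumLattice.FermionGroundStateRangeIndependence
import Literature.MathematicalPhysics.QuantumManyBody.StateRelaxationKKT
import HarnessLib

/-!
# The pair-sourced `t–t'` window Hamiltonian IS the local Hamiltonian of the sourced interaction;
# ground-state rows (stationarity, Bratteli–Robinson, KKT block) in the window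

Topic `Literature/MathematicalPhysics/QuantumLattice` (namespace = path); cell `hubbard-cq`, seat `hubbard-cq-obsth-1`
(row «pinning-field K5 menu nodes with the pinning term»). Everything is PROVED; no definition, no named fact, no `sorry`.

The tree carries the Koma–Tasaki pair-sourced `t–t'` Hubbard model twice: as the explicit WINDOW operator
`pairSourceWindowHamiltonianTT' g Λ' tp U μ h = H^{tt'}_{Λ'} − μ N_{Λ'} − h (S_{Λ'} + S_{Λ'}ᴴ)`
(`DWaveSourceNNNHoppingWindowHamiltonian`, the Hamiltonian of the cell's torus certificate readers and of their `eom` /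
`kkt` rows) and as the finite-range INTERACTION `hubbardTTPrimeSourcedInteraction 1 tp U μ g h = Φ(1,tp,U) − μ n − h P_g`
(`TIGroundEnergyDensityResponse` §7, the object of the infinite-volume theory: mean energy, translation-invariant minimisers,
Bratteli–Kishimoto–Robinson ground states). `TIGroundEnergyDensityResponse` records the identification of the two as NOT proved
(«they agree bond by bond for even `g`»). This file proves it and draws the consequence the cell's ground-state-class readers need:

* §1 `numberInteraction_localHamiltonian`: `Σ_{X ⊆ Λ} Φ_n X = N_Λ` (`totalNumber`), any dimension.
* §2 `pairSourceInteraction_localHamiltonian`: for a form factor even on the unit steps,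
  `Σ_{X ⊆ Λ'} P_g X = S_{Λ'} + S_{Λ'}ᴴ` (`pairSourceWindow g Λ'`): the bond `{x, x+eᵢ}` of the interaction carries
  `√2 g(eᵢ)(b + bᴴ)`, the window source carries the two oriented terms `(g(±eᵢ)/√2) b`, equal by the singlet symmetry
  `b_{y,x} = b_{x,y}`.
* §3 `hubbardTTPrimeSourcedInteraction_localHamiltonian_eq_pairSourceWindowHamiltonianTT'` (+ the `d`-wave case
  `pairSourceWindowHamiltonianTT'_dWave_eq_localHamiltonian`): `H^{src}_{Λ'}` of the interaction `=` the window Hamiltonian.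
* §4 GROUND-STATE ROWS IN THE WINDOW, in the vocabulary of the certificates (`H^{src,tt'}_{Λ'} =
  pairSourceWindowHamiltonianTT' dWaveFormFactor Λ' tp U μ h`, generators `B ∈ 𝔄_Λ` embedded along `Λ ⊆ Λ'`, `thicken Λ 1 ⊆ Λ'`):
  for every Bratteli–Kishimoto–Robinson ground state `ω` of the sourced interaction — in particular (BKR Thm. 2, tree
  `IsMeanEnergyMinimiser.isGroundState_ttPrimeSourced`) for every translation-invariant minimiser of the sourced mean energy
  `e^{src}_{μ,h}` —
  `ω(H^{src,tt'}_{Λ'} B̃ − B̃ H^{src,tt'}_{Λ'}) = 0` (stationarity / `eom` rows, also summed over a family),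
  `Re ω(Ã⋆ (H Ã − Ã H)) ≥ 0` (Bratteli–Robinson), and `0 ≤ Re ω(kktForm H^{src,tt'}_{Λ'} G B̃)` for every `G ⪰ 0` and EVERY
  finite generator family (charged, odd, …: the sourced model conserves no particle number, so no chemical-potential licence
  is involved) — weak duality for the state-optimality block (Araújo et al. Prop. 11, tree `re_map_kktForm_nonneg`).

HONEST FRAMING (cell hubbard-cq): soundness lemmas; no certificate, no number, no order parameter, no phase word.
Tree search: `lean search 'localHamiltonian.*pairSourceWindow|numberInteraction_localHamiltonian'` — nothing; REUSED
`FermionInteraction.localHamiltonian_eq_sum`, `sum_powerset_eq_of_hubbard_support`, `sum_attach_ite_eq`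
(`HubbardFermionInteractionLocalHamiltonian`), `singletPairAt_comm`, `fermionEmbed_incl_singletPairAt`,
`IsGroundState.expect_commutator_localHamiltonian_eq_zero_of_thicken_subset`,
`IsGroundState.re_expect_conj_commutator_nonneg_of_thicken_subset` (`FermionGroundStateRangeIndependence`).

References: T. Koma, H. Tasaki, J. Stat. Phys. 76 (1994) 745, §1 (the pair source) [cite: KomaTasaki1994, §1];
H. Araki, H. Moriya, Rev. Math. Phys. 15 (2003) 93, §5.1 (local Hamiltonians `H(I) = Σ_{K ⊆ I} Φ(K)`), Thm. 5.7
[cite: ArakiMoriya2003, §5.1]; O. Bratteli, A. Kishimoto, D. W. Robinson, Commun. Math. Phys. 64 (1978) 41, Thm. 2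
[cite: BratteliKishimotoRobinson1978, Thm. 2]; O. Bratteli, D. W. Robinson, *OAQSM 2* (1997) Prop. 5.3.19
[cite: BratteliRobinsonII1997, Prop. 5.3.19]; M. Araújo, I. Klep, A. J. P. Garner, T. Vértesi, M. Navascués,
arXiv:2311.18707, §3.2 Prop. 11 [cite: AraujoEtAl2023, §3.2 Prop. 11]; D. J. Scalapino, Phys. Rep. 250 (1995) 329, §2
(the `d_{x²−y²}` form factor) [cite: Scalapino1995, §2].
-/

noncomputable section

namespace Literature.MathematicalPhysics.QuantumLattice

open Matrix Finset HubbardWave0 Literature.Probability.LatticeModels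
open Literature.MathematicalPhysics.QuantumManyBody.StateRelaxation
open scoped ComplexOrder BigOperators

/-! ## §1 The local Hamiltonian of the number interaction is the particle number -/

section Number

variable {d : ℕ}

/-- A sum over the ordered sites `PolySite Λ` is the sum over `Λ.attach` through `PolySite.pt`. [folklore] -/
private theorem sum_polySite_eq_sum_attach {M : Type*} [AddCommMonoid M] (Λ : Finset (Site d)) (f : PolySite Λ → M) :
    ∑ a, f a = ∑ x ∈ Λ.attach, f (PolySite.pt x.1 x.2) := by
  let e : PolySite Λ ≃ {x // x ∈ Λ} :=
    ⟨fun a => ⟨ofLex a.1, PolySite.ofLex_mem a⟩, fun x => PolySite.pt x.1 x.2, fun a => PolySite.pt_ofLex a,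
      fun x => Subtype.ext rfl⟩
  rw [← Finset.univ_eq_attach]
  exact Fintype.sum_equiv e f (fun x => f (PolySite.pt x.1 x.2)) fun a => by
    rw [show PolySite.pt (e a).1 (e a).2 = e.symm (e a) from rfl, Equiv.symm_apply_apply]

/-- **`Σ_{X ⊆ Λ} Φ_n X = N_Λ`**: the local Hamiltonian of the particle-number interaction is the particle number of
the region (`totalNumber`). [cite: ArakiMoriya2003, §5.1] -/
theorem numberInteraction_localHamiltonian (Λ : Finset (Site d)) :
    (numberInteraction d).localHamiltonian Λ = (totalNumber : FermionOp Λ) := by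
  classical
  rw [FermionInteraction.localHamiltonian_eq_sum,
    sum_powerset_eq_of_hubbard_support Λ _ (fun X h1 _ => by
      by_cases h : X ⊆ Λ
      · rw [dif_pos h, numberInteraction_apply_eq_zero h1, map_zero]
      · rw [dif_neg h])]
  -- the bond terms vanish
  have hbond : ∀ (x : Site d) (i : Fin d),
      (if h : ({x, x + unitVec i} : Finset (Site d)) ⊆ Λ then
        fermionEmbed (PolySite.incl h) ((numberInteraction d).Φ {x, x + unitVec i}) else 0) = 0 := by
    intro x i
    by_cases h : ({x, x + unitVec i} : Finset (Site d)) ⊆ Λ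
    · rw [dif_pos h, numberInteraction_apply_eq_zero, map_zero]
      intro y hy
      have := congrArg Finset.card hy
      rw [card_pair (self_ne_add_unitVec x i), card_singleton] at this
      exact absurd this (by norm_num)
    · rw [dif_neg h]
  simp only [hbond, Finset.sum_const_zero, add_zero]
  rw [totalNumber, sum_polySite_eq_sum_attach, ← Finset.sum_attach Λ]
  refine Finset.sum_congr rfl fun x _ => ?_
  rw [dif_pos (singleton_subset_iff.2 x.2), numberInteraction_apply_singleton, map_add, nAt, nAt,
    fermionEmbed_numberOp, fermionEmbed_numberOp, PolySite.incl_pt, Fin.sum_univ_two]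

end Number

/-! ## §2 The local Hamiltonian of the pair-source interaction is the window source plus its adjoint -/

section PairSource

variable (g : Site 2 → ℝ)

/-- `a/√2 + a/√2 = √2·a`. [folklore] -/
private theorem div_sqrt_two_add_div_sqrt_two (a : ℝ) : a / Real.sqrt 2 + a / Real.sqrt 2 = Real.sqrt 2 * a := by
  have h2 : Real.sqrt 2 * Real.sqrt 2 = 2 := Real.mul_self_sqrt (by norm_num)
  have hne : Real.sqrt 2 ≠ 0 := by positivity
  rw [← add_div, div_eq_iff hne, mul_right_comm, h2]
  ring

/-- `c • (B + Bᴴ) = c • B + (c • B)ᴴ` for a real scalar. [folklore] -/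
private theorem real_smul_add_conjTranspose {Λ' : Finset (Site 2)} (c : ℝ) (B : FermionOp Λ') :
    ((c : ℝ) : ℂ) • (B + Bᴴ) = ((c : ℝ) : ℂ) • B + (((c : ℝ) : ℂ) • B)ᴴ := by
  rw [smul_add, Matrix.conjTranspose_smul, Complex.star_def, Complex.conj_ofReal]

/-- `y = x + (−e) ↔ x = y + e` in `ℤ²`. [folklore] -/
private theorem eq_add_neg_iff_eq_add (x y e : Site 2) : y = x + -e ↔ x = y + e := by
  constructor
  · rintro rfl; abel
  · rintro rfl; abel

/-- **`Σ_{X ⊆ Λ'} P_g X = S_{Λ'} + S_{Λ'}ᴴ`** for a form factor even on the unit steps: the local Hamiltonian of the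
pair-source interaction (`Φ{x} = (g0/√2)(b_{xx} + b_{xx}ᴴ)`, `Φ{x, x+eᵢ} = √2 g(eᵢ)(b_{x,x+eᵢ} + h.c.)`) is the window pair source
`S_{Λ'} = Σ_{x ∈ Λ'} Σ_{e ∈ {0,±e₁,±e₂}, x+e ∈ Λ'} (g(e)/√2) b_{x,x+e}` plus its adjoint — the two oriented terms `(x, eᵢ)` and
`(x + eᵢ, −eᵢ)` of one bond coincide by the singlet symmetry `b_{y,x} = b_{x,y}` and `g(−eᵢ) = g(eᵢ)`.
[cite: KomaTasaki1994, §1] [cite: ArakiMoriya2003, §5.1] -/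
theorem pairSourceInteraction_localHamiltonian (hg : ∀ i : Fin 2, g (-unitVec i) = g (unitVec i))
    (Λ' : Finset (Site 2)) :
    (pairSourceInteraction g).localHamiltonian Λ' = pairSourceWindow g Λ' + (pairSourceWindow g Λ')ᴴ := by
  classical
  -- the on-site and the bond building blocks, indexed by the sites of `Λ'`
  set A0 : {x // x ∈ Λ'} → FermionOp Λ' := fun x =>
    ((g 0 / Real.sqrt 2 : ℝ) : ℂ) • singletPairAt x.1 x.1 x.2 x.2 with hA0
  set A1 : Fin 2 → {x // x ∈ Λ'} → FermionOp Λ' := fun i x =>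
    if h : x.1 + unitVec i ∈ Λ' then
      ((Real.sqrt 2 * g (unitVec i) : ℝ) : ℂ) • singletPairAt x.1 (x.1 + unitVec i) x.2 h else 0 with hA1
  -- the oriented bond term of the window source
  set T : {x // x ∈ Λ'} → Site 2 → FermionOp Λ' := fun x e =>
    if h : x.1 + e ∈ Λ' then ((g e / Real.sqrt 2 : ℝ) : ℂ) • singletPairAt x.1 (x.1 + e) x.2 h else 0 with hT
  -- (1) the window source as on-site blocks plus, per direction, the two orientations
  have hwin : pairSourceWindow g Λ' =
      ∑ x ∈ Λ'.attach, A0 x + ∑ i : Fin 2, (∑ x ∈ Λ'.attach, T x (unitVec i) + ∑ x ∈ Λ'.attach, T x (-unitVec i)) := by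
    have hx0 : ∀ x : {x // x ∈ Λ'}, T x 0 = A0 x := by
      intro x
      have hmem : x.1 + 0 ∈ Λ' := by rw [add_zero]; exact x.2
      rw [hT, hA0]
      dsimp only
      rw [dif_pos hmem, singletPairAt_congr x.2 hmem x.2 x.2 rfl (add_zero _)]
    have hsplit : ∀ x : {x // x ∈ Λ'},
        ∑ e ∈ unitSteps, T x e = ∑ i : Fin 2, (T x (unitVec i) + T x (-unitVec i)) := by
      intro x
      rw [sum_unitSteps, Fin.sum_univ_two]
      simp only [unitVec]
      abel
    have hterm : ∀ x : {x // x ∈ Λ'},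
        ∑ e ∈ insert (0 : Site 2) unitSteps, T x e = A0 x + ∑ i : Fin 2, (T x (unitVec i) + T x (-unitVec i)) := by
      intro x
      rw [Finset.sum_insert zero_not_mem_unitSteps, hx0, hsplit]
    unfold pairSourceWindow
    rw [show (∑ x ∈ Λ'.attach, ∑ e ∈ insert (0 : Site 2) unitSteps,
        if h : x.1 + e ∈ Λ' then ((g e / Real.sqrt 2 : ℝ) : ℂ) •
          (cAt x.1 x.2 0 * cAt (x.1 + e) h 1 - cAt x.1 x.2 1 * cAt (x.1 + e) h 0) else 0) =
        ∑ x ∈ Λ'.attach, ∑ e ∈ insert (0 : Site 2) unitSteps, T x e from rfl]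
    simp_rw [hterm]
    rw [Finset.sum_add_distrib, Finset.sum_comm]
    simp only [Finset.sum_add_distrib]
  -- (2) the `−eᵢ` orientation, re-indexed by the left end of the bond, is the `+eᵢ` orientation
  have hminus : ∀ i : Fin 2, ∑ x ∈ Λ'.attach, T x (-unitVec i) = ∑ x ∈ Λ'.attach, T x (unitVec i) := by
    intro i
    set G : {x // x ∈ Λ'} → {x // x ∈ Λ'} → FermionOp Λ' := fun x y =>
      ((g (-unitVec i) / Real.sqrt 2 : ℝ) : ℂ) • singletPairAt x.1 y.1 x.2 y.2 with hG
    have h1 : ∀ x : {x // x ∈ Λ'}, T x (-unitVec i) =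
        ∑ y ∈ Λ'.attach, if y.1 = x.1 + -unitVec i then G x y else 0 := by
      intro x
      rw [sum_attach_ite_eq Λ' (x.1 + -unitVec i) (G x)]
    have h2 : ∀ y : {x // x ∈ Λ'},
        ∑ x ∈ Λ'.attach, (if y.1 = x.1 + -unitVec i then G x y else 0) = T y (unitVec i) := by
      intro y
      have hre : ∀ x : {x // x ∈ Λ'}, (if y.1 = x.1 + -unitVec i then G x y else 0) =
          if x.1 = y.1 + unitVec i then G x y else 0 := fun x => by
        rw [if_congr (eq_add_neg_iff_eq_add x.1 y.1 (unitVec i)) rfl rfl]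
      simp_rw [hre]
      rw [sum_attach_ite_eq Λ' (y.1 + unitVec i) (fun x => G x y)]
      by_cases hy : y.1 + unitVec i ∈ Λ'
      · rw [dif_pos hy, hT, hG]
        dsimp only
        rw [dif_pos hy, hg i, singletPairAt_comm]
      · rw [dif_neg hy, hT]
        dsimp only
        rw [dif_neg hy]
    simp_rw [h1]
    rw [Finset.sum_comm]
    exact Finset.sum_congr rfl fun y _ => h2 y
  -- (3) the two orientations add up to the bond block
  have hbond : ∀ i : Fin 2, ∑ x ∈ Λ'.attach, T x (unitVec i) + ∑ x ∈ Λ'.attach, T x (-unitVec i) =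
      ∑ x ∈ Λ'.attach, A1 i x := by
    intro i
    rw [hminus i, ← Finset.sum_add_distrib]
    refine Finset.sum_congr rfl fun x _ => ?_
    rw [hT, hA1]
    dsimp only
    by_cases h : x.1 + unitVec i ∈ Λ'
    · rw [dif_pos h, dif_pos h, ← add_smul, ← Complex.ofReal_add, div_sqrt_two_add_div_sqrt_two]
    · rw [dif_neg h, dif_neg h, add_zero]
  have hwin' : pairSourceWindow g Λ' = ∑ x ∈ Λ'.attach, A0 x + ∑ i : Fin 2, ∑ x ∈ Λ'.attach, A1 i x := by
    rw [hwin]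
    exact congrArg _ (Finset.sum_congr rfl fun i _ => hbond i)
  -- (4) the local Hamiltonian over sites and bonds
  rw [FermionInteraction.localHamiltonian_eq_sum,
    sum_powerset_eq_of_hubbard_support Λ' _ (fun X h1 h2 => by
      by_cases h : X ⊆ Λ'
      · rw [dif_pos h, pairSourceInteraction_apply_eq_zero g h1 h2, map_zero]
      · rw [dif_neg h])]
  have hsite : ∑ x ∈ Λ', (if h : ({x} : Finset (Site 2)) ⊆ Λ' then
      fermionEmbed (PolySite.incl h) ((pairSourceInteraction g).Φ {x}) else 0) =
      ∑ x ∈ Λ'.attach, (A0 x + (A0 x)ᴴ) := by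
    rw [← Finset.sum_attach Λ']
    refine Finset.sum_congr rfl fun x _ => ?_
    rw [dif_pos (singleton_subset_iff.2 x.2), pairSourceInteraction_apply_singleton, fermionEmbed_smul,
      fermionEmbed_add, fermionEmbed_conjTranspose, fermionEmbed_incl_singletPairAt, hA0]
    exact real_smul_add_conjTranspose _ _
  have hpair : ∑ p ∈ (Λ' ×ˢ (univ : Finset (Fin 2))) with p.1 + unitVec p.2 ∈ Λ',
      (if h : ({p.1, p.1 + unitVec p.2} : Finset (Site 2)) ⊆ Λ' then
        fermionEmbed (PolySite.incl h) ((pairSourceInteraction g).Φ {p.1, p.1 + unitVec p.2}) else 0) =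
      ∑ i : Fin 2, ∑ x ∈ Λ'.attach, (A1 i x + (A1 i x)ᴴ) := by
    rw [Finset.sum_filter, Finset.sum_product, ← Finset.sum_attach Λ', Finset.sum_comm]
    refine Finset.sum_congr rfl fun i _ => Finset.sum_congr rfl fun x _ => ?_
    rw [hA1]
    dsimp only
    by_cases h : x.1 + unitVec i ∈ Λ'
    · have hsub : ({x.1, x.1 + unitVec i} : Finset (Site 2)) ⊆ Λ' := insert_subset x.2 (singleton_subset_iff.2 h)
      rw [if_pos h, dif_pos hsub, dif_pos h, pairSourceInteraction_apply_pair, fermionEmbed_smul, fermionEmbed_add,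
        fermionEmbed_conjTranspose, fermionEmbed_incl_singletPairAt]
      exact real_smul_add_conjTranspose _ _
    · rw [if_neg h, dif_neg h, Matrix.conjTranspose_zero, add_zero]
  rw [hsite, hpair, hwin']
  simp only [Finset.sum_add_distrib, Matrix.conjTranspose_add, Matrix.conjTranspose_sum]
  abel

end PairSource

/-! ## §3 The window Hamiltonian of the certificates IS the local Hamiltonian of the sourced interaction -/

section Identification

variable (g : Site 2 → ℝ)

/-- **`H^{src}_{Λ'}(interaction) = H^{src,tt'}_{Λ'}(window)`**: for a form factor even on the unit steps,
`(Φ(1,tp,U) − μ n − h P_g)`'s local Hamiltonian of the window `Λ'` is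
`pairSourceWindowHamiltonianTT' g Λ' tp U μ h = H^{tt'}_{Λ'} − μ N_{Λ'} − h (S_{Λ'} + S_{Λ'}ᴴ)`.
[cite: KomaTasaki1994, §1] [cite: ArakiMoriya2003, §5.1] -/
theorem hubbardTTPrimeSourcedInteraction_localHamiltonian_eq_pairSourceWindowHamiltonianTT'
    (hg : ∀ i : Fin 2, g (-unitVec i) = g (unitVec i)) (tp U μ h : ℝ) (Λ' : Finset (Site 2)) :
    (hubbardTTPrimeSourcedInteraction 1 tp U μ g h).localHamiltonian Λ' = pairSourceWindowHamiltonianTT' g Λ' tp U μ h := by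
  rw [pairSourceWindowHamiltonianTT'_eq, hubbardTTPrimeSourcedInteraction_localHamiltonian,
    hubbardTTPrimeMuInteraction_localHamiltonian, numberInteraction_localHamiltonian,
    pairSourceInteraction_localHamiltonian g hg, Complex.ofReal_neg, Complex.ofReal_neg, neg_smul, neg_smul]
  abel

/-- The `d_{x²−y²}` form factor is even on the unit steps: `g_d(−eᵢ) = g_d(eᵢ)` (Scalapino's `g(±x̂) = 1`, `g(±ŷ) = −1`).
[cite: Scalapino1995, §2 eq. (2.3)] -/
theorem dWaveFormFactor_neg_unitVec (i : Fin 2) : dWaveFormFactor (-unitVec i) = dWaveFormFactor (unitVec i) :=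
  dWaveFormFactor_neg _

/-- **The `d`-wave case**: `pairSourceWindowHamiltonianTT' dWaveFormFactor Λ' tp U μ h =
(hubbardTTPrimeSourcedInteraction 1 tp U μ dWaveFormFactor h).localHamiltonian Λ'` — the window Hamiltonian of the cell's
sourced certificate readers is the local Hamiltonian of the Koma–Tasaki `d`-wave sourced interaction. [cite: KomaTasaki1994, §1] -/
theorem pairSourceWindowHamiltonianTT'_dWave_eq_localHamiltonian (tp U μ h : ℝ) (Λ' : Finset (Site 2)) :
    pairSourceWindowHamiltonianTT' dWaveFormFactor Λ' tp U μ h =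
      (hubbardTTPrimeSourcedInteraction 1 tp U μ dWaveFormFactor h).localHamiltonian Λ' :=
  (hubbardTTPrimeSourcedInteraction_localHamiltonian_eq_pairSourceWindowHamiltonianTT' dWaveFormFactor
    dWaveFormFactor_neg_unitVec tp U μ h Λ').symm

end Identification

/-! ## §4 Ground-state rows in the window, in the vocabulary of the certificates -/

section GroundStateRows

namespace InfVolFermionState

variable {ω : InfVolFermionState 2} {tp U μ h : ℝ} {Λ Λ' : Finset (Site 2)}

/-- **Stationarity (`eom` row) in the window**: for a ground state `ω` of the `d`-wave sourced interaction, every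
`B ∈ 𝔄_Λ` and every window `Λ' ⊇ thicken Λ 1`: `ω(H^{src,tt'}_{Λ'} B̃ − B̃ H^{src,tt'}_{Λ'}) = 0`, `B̃ = Γ(Λ ⊆ Λ') B`.
[cite: BratteliRobinsonII1997, Prop. 5.3.19] [cite: ArakiMoriya2003, Thm. 5.7] -/
theorem IsGroundState.expect_commutator_pairSourceWindowHamiltonianTT'_eq_zero
    (hgs : ω.IsGroundState (hubbardTTPrimeSourcedInteraction 1 tp U μ dWaveFormFactor h) 1)
    (hΛ : Λ ⊆ Λ') (h8 : thicken Λ 1 ⊆ Λ') (B : FermionOp Λ) :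
    ω.expect Λ' (pairSourceWindowHamiltonianTT' dWaveFormFactor Λ' tp U μ h * fermionEmbed (PolySite.incl hΛ) B -
      fermionEmbed (PolySite.incl hΛ) B * pairSourceWindowHamiltonianTT' dWaveFormFactor Λ' tp U μ h) = 0 := by
  rw [pairSourceWindowHamiltonianTT'_dWave_eq_localHamiltonian]
  exact hgs.expect_commutator_localHamiltonian_eq_zero_of_thicken_subset
    (hubbardTTPrimeSourcedInteraction_isEven 1 tp U μ dWaveFormFactor h)
    (hubbardTTPrimeSourcedInteraction_hasFiniteRange 1 tp U μ dWaveFormFactor h) h8 B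

/-- **The `eom` BLOCK of a certificate vanishes**: `ω(Σ_{k ∈ s} (H^{src,tt'}_{Λ'} B̃ₖ − B̃ₖ H^{src,tt'}_{Λ'})) = 0` for a
ground state of the sourced interaction (any finite family `Bₖ ∈ 𝔄_Λ`, `thicken Λ 1 ⊆ Λ'`).
[cite: BratteliRobinsonII1997, Prop. 5.3.19] -/
theorem IsGroundState.expect_sum_commutator_pairSourceWindowHamiltonianTT'_eq_zero
    (hgs : ω.IsGroundState (hubbardTTPrimeSourcedInteraction 1 tp U μ dWaveFormFactor h) 1)
    (hΛ : Λ ⊆ Λ') (h8 : thicken Λ 1 ⊆ Λ') {κ' : Type*} (s : Finset κ') (B : κ' → FermionOp Λ) :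
    ω.expect Λ' (∑ k ∈ s,
      (pairSourceWindowHamiltonianTT' dWaveFormFactor Λ' tp U μ h * fermionEmbed (PolySite.incl hΛ) (B k) -
        fermionEmbed (PolySite.incl hΛ) (B k) * pairSourceWindowHamiltonianTT' dWaveFormFactor Λ' tp U μ h)) = 0 := by
  rw [map_sum]
  exact Finset.sum_eq_zero fun k _ => hgs.expect_commutator_pairSourceWindowHamiltonianTT'_eq_zero hΛ h8 (B k)

/-- **The Bratteli–Robinson inequality in the window**: for a ground state `ω` of the `d`-wave sourced interaction and
every `A ∈ 𝔄_Λ`, `thicken Λ 1 ⊆ Λ'`: `0 ≤ Re ω(Ã⋆ (H^{src,tt'}_{Λ'} Ã − Ã H^{src,tt'}_{Λ'}))` — with NO restriction on the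
charge or parity of `A` (the sourced model conserves no particle number; the `−μN` term is inside the Hamiltonian).
[cite: BratteliKishimotoRobinson1978, §1 (definition of τ-ground state)] [cite: ArakiMoriya2003, Thm. 5.7] -/
theorem IsGroundState.re_expect_conj_commutator_pairSourceWindowHamiltonianTT'_nonneg
    (hgs : ω.IsGroundState (hubbardTTPrimeSourcedInteraction 1 tp U μ dWaveFormFactor h) 1)
    (hΛ : Λ ⊆ Λ') (h8 : thicken Λ 1 ⊆ Λ') (A : FermionOp Λ) :
    0 ≤ (ω.expect Λ' ((fermionEmbed (PolySite.incl hΛ) A)ᴴ *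
      (pairSourceWindowHamiltonianTT' dWaveFormFactor Λ' tp U μ h * fermionEmbed (PolySite.incl hΛ) A -
        fermionEmbed (PolySite.incl hΛ) A * pairSourceWindowHamiltonianTT' dWaveFormFactor Λ' tp U μ h))).re := by
  rw [pairSourceWindowHamiltonianTT'_dWave_eq_localHamiltonian]
  exact hgs.re_expect_conj_commutator_nonneg_of_thicken_subset
    (hubbardTTPrimeSourcedInteraction_isEven 1 tp U μ dWaveFormFactor h)
    (hubbardTTPrimeSourcedInteraction_hasFiniteRange 1 tp U μ dWaveFormFactor h) h8 A

/-- **The state-optimality (`kkt`) BLOCK is nonnegative in every ground state**: for `G ⪰ 0` and ANY finite generator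
family `Bk_b ∈ 𝔄_Λ` (`thicken Λ 1 ⊆ Λ'`), `0 ≤ Re ω(kktForm H^{src,tt'}_{Λ'} G B̃)`,
`kktForm H G B̃ = Σ_ab G_ab • (B̃_a⋆ (H B̃_b − B̃_b H))` — weak duality for the PSD-weighted ground-state inequality on the
span of the generators. [cite: AraujoEtAl2023, §3.2 Prop. 11] [cite: BratteliKishimotoRobinson1978, §1] -/
theorem IsGroundState.re_expect_kktForm_pairSourceWindowHamiltonianTT'_nonneg
    (hgs : ω.IsGroundState (hubbardTTPrimeSourcedInteraction 1 tp U μ dWaveFormFactor h) 1)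
    (hΛ : Λ ⊆ Λ') (h8 : thicken Λ 1 ⊆ Λ') {β : Type*} [Fintype β] [DecidableEq β] {G : Matrix β β ℂ}
    (hG : G.PosSemidef) (Bk : β → FermionOp Λ) :
    0 ≤ (ω.expect Λ' (kktForm (pairSourceWindowHamiltonianTT' dWaveFormFactor Λ' tp U μ h) G
      (fun b => fermionEmbed (PolySite.incl hΛ) (Bk b)))).re := by
  refine re_map_kktForm_nonneg (ω.expect Λ') _ hG _ fun w => ?_
  have hsum : ∑ j, w j • fermionEmbed (PolySite.incl hΛ) (Bk j) = fermionEmbed (PolySite.incl hΛ) (∑ j, w j • Bk j) := by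
    rw [map_sum]
    exact Finset.sum_congr rfl fun j _ => (fermionEmbed_smul _ _ _).symm
  rw [hsum, Matrix.star_eq_conjTranspose]
  exact hgs.re_expect_conj_commutator_pairSourceWindowHamiltonianTT'_nonneg hΛ h8 _

/-- **Translation-invariant MINIMISERS of the sourced mean energy obey the `eom` rows** (Bratteli–Kishimoto–Robinson Thm. 2,
`2 ⇒ 1`, tree `IsMeanEnergyMinimiser.isGroundState_ttPrimeSourced`): `ω(H^{src,tt'}_{Λ'} B̃ − B̃ H^{src,tt'}_{Λ'}) = 0`.
[cite: BratteliKishimotoRobinson1978, Thm. 2] -/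
theorem IsMeanEnergyMinimiser.expect_commutator_pairSourceWindowHamiltonianTT'_eq_zero
    (hmin : ω.IsMeanEnergyMinimiser (hubbardTTPrimeSourcedInteraction 1 tp U μ dWaveFormFactor h) 1)
    (hΛ : Λ ⊆ Λ') (h8 : thicken Λ 1 ⊆ Λ') (B : FermionOp Λ) :
    ω.expect Λ' (pairSourceWindowHamiltonianTT' dWaveFormFactor Λ' tp U μ h * fermionEmbed (PolySite.incl hΛ) B -
      fermionEmbed (PolySite.incl hΛ) B * pairSourceWindowHamiltonianTT' dWaveFormFactor Λ' tp U μ h) = 0 :=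
  hmin.isGroundState_ttPrimeSourced.expect_commutator_pairSourceWindowHamiltonianTT'_eq_zero hΛ h8 B

/-- **Minimisers: the `eom` block vanishes.** [cite: BratteliKishimotoRobinson1978, Thm. 2] -/
theorem IsMeanEnergyMinimiser.expect_sum_commutator_pairSourceWindowHamiltonianTT'_eq_zero
    (hmin : ω.IsMeanEnergyMinimiser (hubbardTTPrimeSourcedInteraction 1 tp U μ dWaveFormFactor h) 1)
    (hΛ : Λ ⊆ Λ') (h8 : thicken Λ 1 ⊆ Λ') {κ' : Type*} (s : Finset κ') (B : κ' → FermionOp Λ) :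
    ω.expect Λ' (∑ k ∈ s,
      (pairSourceWindowHamiltonianTT' dWaveFormFactor Λ' tp U μ h * fermionEmbed (PolySite.incl hΛ) (B k) -
        fermionEmbed (PolySite.incl hΛ) (B k) * pairSourceWindowHamiltonianTT' dWaveFormFactor Λ' tp U μ h)) = 0 :=
  hmin.isGroundState_ttPrimeSourced.expect_sum_commutator_pairSourceWindowHamiltonianTT'_eq_zero hΛ h8 s B

/-- **Minimisers: the Bratteli–Robinson inequality**, every local `A`. [cite: BratteliKishimotoRobinson1978, Thm. 2] -/
theorem IsMeanEnergyMinimiser.re_expect_conj_commutator_pairSourceWindowHamiltonianTT'_nonneg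
    (hmin : ω.IsMeanEnergyMinimiser (hubbardTTPrimeSourcedInteraction 1 tp U μ dWaveFormFactor h) 1)
    (hΛ : Λ ⊆ Λ') (h8 : thicken Λ 1 ⊆ Λ') (A : FermionOp Λ) :
    0 ≤ (ω.expect Λ' ((fermionEmbed (PolySite.incl hΛ) A)ᴴ *
      (pairSourceWindowHamiltonianTT' dWaveFormFactor Λ' tp U μ h * fermionEmbed (PolySite.incl hΛ) A -
        fermionEmbed (PolySite.incl hΛ) A * pairSourceWindowHamiltonianTT' dWaveFormFactor Λ' tp U μ h))).re :=
  hmin.isGroundState_ttPrimeSourced.re_expect_conj_commutator_pairSourceWindowHamiltonianTT'_nonneg hΛ h8 A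

/-- **Minimisers: the `kkt` block is nonnegative**, every `G ⪰ 0`, every finite generator family.
[cite: AraujoEtAl2023, §3.2 Prop. 11] [cite: BratteliKishimotoRobinson1978, Thm. 2] -/
theorem IsMeanEnergyMinimiser.re_expect_kktForm_pairSourceWindowHamiltonianTT'_nonneg
    (hmin : ω.IsMeanEnergyMinimiser (hubbardTTPrimeSourcedInteraction 1 tp U μ dWaveFormFactor h) 1)
    (hΛ : Λ ⊆ Λ') (h8 : thicken Λ 1 ⊆ Λ') {β : Type*} [Fintype β] [DecidableEq β] {G : Matrix β β ℂ}
    (hG : G.PosSemidef) (Bk : β → FermionOp Λ) :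
    0 ≤ (ω.expect Λ' (kktForm (pairSourceWindowHamiltonianTT' dWaveFormFactor Λ' tp U μ h) G
      (fun b => fermionEmbed (PolySite.incl hΛ) (Bk b)))).re :=
  hmin.isGroundState_ttPrimeSourced.re_expect_kktForm_pairSourceWindowHamiltonianTT'_nonneg hΛ h8 hG Bk

end InfVolFermionState

end GroundStateRows

end Literature.MathematicalPhysics.QuantumLattice

end
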